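import Summits.MatrixMultiplication.MatrixMultiplication.Theses.EPRFaces
import Summits.MatrixMultiplication.MatrixMultiplication.Theorems.ShapeSubmodularityPerfectAmortisation
import Summits.MatrixMultiplication.MatrixMultiplication.Theorems.EPRFacesModuleGrowthRefutes

/-!
# `¬ ModuleRankGrowth` — the refutation face of route EPRFaces closes (candidate for
stmt-MatrixMultiplication-7244)

`ModuleRankGrowth` (EPRFaces crux #4: `∃ c > 0, n₀, ∀ n ≥ n₀, R(⟨n,n,N⟩) ≥ n^{1+c}·N` for all large
`N`) contradicts the crux E `PerfectAmortisation` (Coppersmith 1982 / Lotti–Romani 1983, proved in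
`ShapeSubmodularityPerfectAmortisation.lean`) through the proved support `ModuleGrowthRefutes`
(stmt-MatrixMultiplication-10899: `ModuleRankGrowth → ¬E ∧ ω ≠ 2`).  Hence `¬ ModuleRankGrowth`
(refuted-substantive: the load-bearing claim — superlinear module rank per vector — is false; every
c > 0 fails, no cheap repair), contracting route EPRFaces to "B ⇔ ω = 2" as its kill criteria foresee.
-/

/-- **Record of the dropped route item `ModuleRankGrowth`** = stmt-MatrixMultiplication-7244 (ledger signature verbatim; NOT a route
item): route EPRFaces rev 2 (2026-08-17T09:14Z) dropped the refuted `ModuleRankGrowth`; the route is now closed (exhausted). The declaration `Summit.MatrixMultiplication.MatrixMultiplication.Theses.EPRFaces.ModuleRankGrowth`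
therefore no longer exists in the route file and this accepted module stopped elaborating (stale olean;
buildfix lane 2026-08-19). Re-created here under its original name so the result keeps building; the
statement of every previously accepted declaration in this file is unchanged. -/
def _root_.Summit.MatrixMultiplication.MatrixMultiplication.Theses.EPRFaces.ModuleRankGrowth : Prop :=
  ∃ c : ℝ, 0 < c ∧ ∃ n₀ : ℕ, ∀ n : ℕ, n₀ ≤ n → ∃ N₀ : ℕ, ∀ N : ℕ, N₀ ≤ N → (n : ℝ) ^ (1 + c) * (N : ℝ) ≤ (Literature.Computability.AlgebraicComplexity.tensorRank (Literature.Computability.AlgebraicComplexity.matMulTensor ℂ n n N) : ℝ)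


set_option linter.dupNamespace false
-- (single-conjunct summit: the namespace repeats `MatrixMultiplication`)

namespace Summit.MatrixMultiplication.MatrixMultiplication.Theorems.PerfectAmortisation

/-- **`ModuleRankGrowth` is false** (refuted-substantive; witness: E = `perfectAmortisation_proof`
fed to `ModuleGrowthRefutes_proof`): there is no `c > 0` with `R(⟨n,n,N⟩) ≥ n^{1+c}·N` for all large
`n` and `N`. -/
theorem not_ModuleRankGrowth :
    ¬ Summit.MatrixMultiplication.MatrixMultiplication.Theses.EPRFaces.ModuleRankGrowth := fun h =>
  (Summit.MatrixMultiplication.MatrixMultiplication.Theorems.ModuleGrowthRefutes_proof h).1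
    perfectAmortisation_proof

end Summit.MatrixMultiplication.MatrixMultiplication.Theorems.PerfectAmortisation
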